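import Mathlib.Data.Real.Basic
import Mathlib.Algebra.Order.BigOperators.Group.Finset
import Mathlib.Tactic.Linarith
import Mathlib.Tactic.Ring
import Literature.Computability.Complexity.NegationElimination
import HarnessLib

/-!
# Razborov's approximation method along a monotone straight-line program (generic form)

The bookkeeping half of Razborov's method of approximations (Razborov 1985; Alon–Boppana 1987,
Thm. 2.1; in the form used by Cavalar–Kumar–Rossman 2022, §2 and Lemma 2.18): given

* a class of *approximators* `β` with a semantics `val : β → (ι → Bool) → Bool`, approximate
  operations `⊔, ⊓` preserving the class, and exact approximators of the input variables
  (`ApproxScheme`), and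
* weighted families of *positive* and *negative* test inputs on which a single approximate `∨`
  (resp. `∧`) loses at most `δ⁺` positive weight (`val a ∨ val b` true but `val (a ⊔ b)` false)
  and gains at most `δ⁻` negative weight,

replacing the gates of a program over `{∧₂, ∨₂}` one by one by approximate gates yields an
approximator of every wire together with global exceptional sets `Bad⁺`, `Bad⁻` of total weight
at most `#gates · δ⁺`, `#gates · δ⁻`, outside of which "wire true ⇒ approximator true" on positive
inputs and "approximator true ⇒ wire true" on negative inputs (`exists_approx_gates`,
`exists_approx_circuit`). The CLIQUE-specific instance of this induction is
`CliqueApproximators.exists_rApprox_gates`; here the lattice, the test inputs and the error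
estimates are parameters, as needed for the Harnik–Raz function (`RobustSunflowerBound.lean`).

## References

* A. A. Razborov, *Lower bounds on the monotone complexity of some Boolean functions*, Dokl.
  Akad. Nauk SSSR 281 (1985) [Razborov1985].
* N. Alon, R. B. Boppana, *The monotone circuit complexity of Boolean functions*, Combinatorica
  7 (1987), Thm. 2.1 [AlonBoppana1987].
* B. P. Cavalar, M. Kumar, B. Rossman, *Monotone circuit lower bounds from robust sunflowers*,
  Algorithmica 84 (2022), §2.6 and Lemma 2.18 [CavalarKumarRossman2022].
-/

namespace Literature.Computability.Complexity

open Finset GateList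

variable {ι β σ τ : Type*}

/-- An *approximation scheme* for monotone circuits over the variables `ι` (Razborov 1985;
Alon–Boppana 1987, §2: a "legitimate model" — a lattice of approximators containing the
variables, with approximate join and meet): `ok` singles out the approximators, `val` is their
semantics as monotone Boolean functions, `sup`/`inf` are the approximate `∨`/`∧`, and `inp i`
approximates (exactly) the variable `x_i`. [cite: AlonBoppana1987, §2] -/
structure ApproxScheme (ι β : Type*) where
  /-- membership in the class of approximators -/
  ok : β → Prop
  /-- the Boolean function denoted by an approximator -/
  val : β → (ι → Bool) → Bool
  /-- approximate disjunction -/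
  sup : β → β → β
  /-- approximate conjunction -/
  inf : β → β → β
  /-- the approximator of an input variable -/
  inp : ι → β
  /-- inputs are approximators -/
  ok_inp : ∀ i, ok (inp i)
  /-- the class is closed under approximate disjunction -/
  ok_sup : ∀ a b, ok a → ok b → ok (sup a b)
  /-- the class is closed under approximate conjunction -/
  ok_inf : ∀ a b, ok a → ok b → ok (inf a b)
  /-- inputs are approximated exactly -/
  val_inp : ∀ i x, val (inp i) x = x i

namespace ApproxScheme

variable (S : ApproxScheme ι β)

/-- The positive test inputs lost by one approximate disjunction `a ⊔ b`. [cite: CavalarKumarRossman2022, Lemma 2.18] -/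
def lostSup (P : Finset σ) (pt : σ → ι → Bool) (a b : β) : Finset σ :=
  P.filter fun s => (S.val a (pt s) || S.val b (pt s)) = true ∧ S.val (S.sup a b) (pt s) = false

/-- The positive test inputs lost by one approximate conjunction `a ⊓ b`. [cite: CavalarKumarRossman2022, Lemma 2.18] -/
def lostInf (P : Finset σ) (pt : σ → ι → Bool) (a b : β) : Finset σ :=
  P.filter fun s => (S.val a (pt s) && S.val b (pt s)) = true ∧ S.val (S.inf a b) (pt s) = false

/-- The negative test inputs gained by one approximate disjunction `a ⊔ b`. [cite: CavalarKumarRossman2022, Lemma 2.18] -/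
def gainedSup (N : Finset τ) (pt : τ → ι → Bool) (a b : β) : Finset τ :=
  N.filter fun s => (S.val a (pt s) || S.val b (pt s)) = false ∧ S.val (S.sup a b) (pt s) = true

/-- The negative test inputs gained by one approximate conjunction `a ⊓ b`. [cite: CavalarKumarRossman2022, Lemma 2.18] -/
def gainedInf (N : Finset τ) (pt : τ → ι → Bool) (a b : β) : Finset τ :=
  N.filter fun s => (S.val a (pt s) && S.val b (pt s)) = false ∧ S.val (S.inf a b) (pt s) = true

/-- The invariant of the approximator `a` of a wire computing `v`, relative to the global
exceptional sets: `a` is an approximator; on positive test inputs outside `BadP`, if the wire is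
true then so is `a`; on negative test inputs outside `BadN`, if `a` is true then so is the wire
(Alon–Boppana 1987, (2.1)–(2.2); CKR 2022, proof of Lemma 2.18). [cite: AlonBoppana1987, Thm. 2.1] -/
structure WireApprox (P : Finset σ) (ptP : σ → ι → Bool) (N : Finset τ) (ptN : τ → ι → Bool)
    (BadP : Finset σ) (BadN : Finset τ) (a : β) (v : (ι → Bool) → Bool) : Prop where
  /-- the approximator is in the class -/
  ok : S.ok a
  /-- positive inputs: wire true ⇒ approximator true, unless exceptional -/
  pos : ∀ s ∈ P, s ∉ BadP → v (ptP s) = true → S.val a (ptP s) = true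
  /-- negative inputs: approximator true ⇒ wire true, unless exceptional -/
  neg : ∀ s ∈ N, s ∉ BadN → S.val a (ptN s) = true → v (ptN s) = true

namespace WireApprox

variable {S} {P : Finset σ} {ptP : σ → ι → Bool} {N : Finset τ} {ptN : τ → ι → Bool}
  {BadP BadP' : Finset σ} {BadN BadN' : Finset τ} {a b : β} {v v' u : (ι → Bool) → Bool}

/-- Enlarging the exceptional sets preserves the invariant. [folklore] -/
theorem mono (h : S.WireApprox P ptP N ptN BadP BadN a v) (hP : BadP ⊆ BadP') (hN : BadN ⊆ BadN') :
    S.WireApprox P ptP N ptN BadP' BadN' a v where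
  ok := h.ok
  pos s hs hsB := h.pos s hs fun h' => hsB (hP h')
  neg s hs hsB := h.neg s hs fun h' => hsB (hN h')

/-- The invariant only depends on the function computed by the wire. [folklore] -/
theorem congr (h : S.WireApprox P ptP N ptN BadP BadN a v) (hv : ∀ x, v x = v' x) :
    S.WireApprox P ptP N ptN BadP BadN a v' where
  ok := h.ok
  pos s hs hsB hv' := h.pos s hs hsB ((hv _).trans hv')
  neg s hs hsB ha := (hv _).symm.trans (h.neg s hs hsB ha)

variable (S P ptP N ptN) in
/-- Input wires are approximated exactly. [cite: AlonBoppana1987, Thm. 2.1] -/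
theorem input (i : ι) : S.WireApprox P ptP N ptN ∅ ∅ (S.inp i) fun x => x i where
  ok := S.ok_inp i
  pos _ _ _ h := (S.val_inp i _).trans h
  neg _ _ _ h := (S.val_inp i _).symm.trans h

variable [DecidableEq σ] [DecidableEq τ]

/-- **OR gates**: the approximate disjunction, with the lost/gained inputs added to the
exceptional sets. [cite: AlonBoppana1987, Thm. 2.1] -/
theorem or_gate (ha : S.WireApprox P ptP N ptN BadP BadN a u) (hb : S.WireApprox P ptP N ptN BadP BadN b v) :
    S.WireApprox P ptP N ptN (BadP ∪ S.lostSup P ptP a b) (BadN ∪ S.gainedSup N ptN a b)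
      (S.sup a b) fun x => (u x || v x) where
  ok := S.ok_sup a b ha.ok hb.ok
  pos s hs hsB huv := by
    rw [mem_union, not_or] at hsB
    have hab : (S.val a (ptP s) || S.val b (ptP s)) = true := by
      rw [Bool.or_eq_true] at huv ⊢
      rcases huv with h | h
      · exact Or.inl (ha.pos s hs hsB.1 h)
      · exact Or.inr (hb.pos s hs hsB.1 h)
    by_contra hc
    exact hsB.2 (mem_filter.2 ⟨hs, hab, Bool.eq_false_iff.2 hc⟩)
  neg s hs hsB hsup := by
    rw [mem_union, not_or] at hsB
    have hab : (S.val a (ptN s) || S.val b (ptN s)) = true := by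
      by_contra hc
      exact hsB.2 (mem_filter.2 ⟨hs, Bool.eq_false_iff.2 hc, hsup⟩)
    rw [Bool.or_eq_true] at hab ⊢
    rcases hab with h | h
    · exact Or.inl (ha.neg s hs hsB.1 h)
    · exact Or.inr (hb.neg s hs hsB.1 h)

/-- **AND gates**: the approximate conjunction, with the lost/gained inputs added to the
exceptional sets. [cite: AlonBoppana1987, Thm. 2.1] -/
theorem and_gate (ha : S.WireApprox P ptP N ptN BadP BadN a u) (hb : S.WireApprox P ptP N ptN BadP BadN b v) :
    S.WireApprox P ptP N ptN (BadP ∪ S.lostInf P ptP a b) (BadN ∪ S.gainedInf N ptN a b)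
      (S.inf a b) fun x => (u x && v x) where
  ok := S.ok_inf a b ha.ok hb.ok
  pos s hs hsB huv := by
    rw [mem_union, not_or] at hsB
    rw [Bool.and_eq_true] at huv
    have hab : (S.val a (ptP s) && S.val b (ptP s)) = true := by
      rw [Bool.and_eq_true]
      exact ⟨ha.pos s hs hsB.1 huv.1, hb.pos s hs hsB.1 huv.2⟩
    by_contra hc
    exact hsB.2 (mem_filter.2 ⟨hs, hab, Bool.eq_false_iff.2 hc⟩)
  neg s hs hsB hinf := by
    rw [mem_union, not_or] at hsB
    have hab : (S.val a (ptN s) && S.val b (ptN s)) = true := by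
      by_contra hc
      exact hsB.2 (mem_filter.2 ⟨hs, Bool.eq_false_iff.2 hc, hinf⟩)
    rw [Bool.and_eq_true] at hab ⊢
    exact ⟨ha.neg s hs hsB.1 hab.1, hb.neg s hs hsB.1 hab.2⟩

end WireApprox

/-- Total weight of a finite set of test inputs. [folklore] -/
theorem sum_union_le_of_nonneg {γ : Type*} [DecidableEq γ] {w : γ → ℝ} (hw : ∀ s, 0 ≤ w s)
    (A B : Finset γ) : ∑ s ∈ A ∪ B, w s ≤ ∑ s ∈ A, w s + ∑ s ∈ B, w s := by
  rw [← sum_union_inter]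
  have : 0 ≤ ∑ s ∈ A ∩ B, w s := sum_nonneg fun s _ => hw s
  linarith

variable [DecidableEq σ] [DecidableEq τ] [Inhabited β]

/-- **The approximation method along a straight-line program** (Razborov 1985; Alon–Boppana
1987, Thm. 2.1; CKR 2022, Lemma 2.18): if every approximate `∨`/`∧` of two approximators loses
positive test weight `≤ δP` and gains negative test weight `≤ δN`, then along a well-formed
program over `{∧₂, ∨₂}` every wire has an approximator satisfying the invariant `WireApprox`
relative to exceptional sets of weight `≤ #gates · δP`, `≤ #gates · δN`.
[cite: AlonBoppana1987, Thm. 2.1] -/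
theorem exists_approx_gates (P : Finset σ) (ptP : σ → ι → Bool) (wP : σ → ℝ) (N : Finset τ)
    (ptN : τ → ι → Bool) (wN : τ → ℝ) (hwP : ∀ s, 0 ≤ wP s) (hwN : ∀ s, 0 ≤ wN s) (δP δN : ℝ)
    (hsupP : ∀ a b, S.ok a → S.ok b → ∑ s ∈ S.lostSup P ptP a b, wP s ≤ δP)
    (hinfP : ∀ a b, S.ok a → S.ok b → ∑ s ∈ S.lostInf P ptP a b, wP s ≤ δP)
    (hsupN : ∀ a b, S.ok a → S.ok b → ∑ s ∈ S.gainedSup N ptN a b, wN s ≤ δN)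
    (hinfN : ∀ a b, S.ok a → S.ok b → ∑ s ∈ S.gainedInf N ptN a b, wN s ≤ δN) :
    ∀ gs : List (Gate ι), WF gs → (∀ gt ∈ gs, gt.fn ∈ monotoneBasis) →
      ∃ (ap : ι ⊕ ℕ → β) (BadP : Finset σ) (BadN : Finset τ),
        ∑ s ∈ BadP, wP s ≤ gs.length * δP ∧ ∑ s ∈ BadN, wN s ≤ gs.length * δN ∧
        ∀ w : ι ⊕ ℕ, OutOK gs.length w →
          S.WireApprox P ptP N ptN BadP BadN (ap w) fun x => wireOf x (vals gs x) w := by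
  classical
  intro gs
  induction gs using List.reverseRecOn with
  | nil =>
    intro _ _
    refine ⟨fun w => match w with
      | .inl i => S.inp i
      | .inr _ => default, ∅, ∅, by simp, by simp, fun w hw => ?_⟩
    rcases w with i | m
    · exact WireApprox.input S P ptP N ptN i
    · exact absurd (hw m rfl) (by simp)
  | append_singleton gs gt ih =>
    intro hwf hB
    obtain ⟨ap, BadP, BadN, hcP, hcN, hinv⟩ :=
      ih hwf.of_append_left fun g' hg' => hB g' (List.mem_append_left _ hg')
    have hgOK : GateOK gs.length gt := hwf.gateOK_mid (post := [])
    have hgB : gt.fn ∈ monotoneBasis := hB gt (by simp)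
    -- old wires keep their values and invariants
    have hold : ∀ (BadP' : Finset σ) (BadN' : Finset τ), BadP ⊆ BadP' → BadN ⊆ BadN' →
        ∀ w : ι ⊕ ℕ, OutOK gs.length w →
        S.WireApprox P ptP N ptN BadP' BadN' (ap w) (fun x => wireOf x (vals (gs ++ [gt]) x) w) :=
      fun BadP' BadN' hP' hN' w hw =>
        ((hinv w hw).mono hP' hN').congr fun x => (wireOf_vals_append gs [gt] x w hw).symm
    -- the value of the new gate
    have hnew : ∀ x, wireOf x (vals (gs ++ [gt]) x) (.inr gs.length) =
        gt.op (fun a => wireOf x (vals gs x) (gt.args a)) := fun x => by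
      rw [wireOf_inr, show gs ++ [gt] = gs ++ gt :: [] from rfl, getD_vals_append_cons]
    have hlen : (gs ++ [gt]).length = gs.length + 1 := by simp
    -- how to assemble the conclusion from an approximator of the new gate
    have assemble : ∀ (BadP' : Finset σ) (BadN' : Finset τ) (Fn : β),
        BadP ⊆ BadP' → BadN ⊆ BadN' →
        ∑ s ∈ BadP', wP s ≤ (gs ++ [gt]).length * δP → ∑ s ∈ BadN', wN s ≤ (gs ++ [gt]).length * δN →
        S.WireApprox P ptP N ptN BadP' BadN' Fn (fun x => wireOf x (vals (gs ++ [gt]) x) (.inr gs.length)) →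
        ∃ (ap : ι ⊕ ℕ → β) (BadP : Finset σ) (BadN : Finset τ),
          ∑ s ∈ BadP, wP s ≤ (gs ++ [gt]).length * δP ∧ ∑ s ∈ BadN, wN s ≤ (gs ++ [gt]).length * δN ∧
          ∀ w : ι ⊕ ℕ, OutOK (gs ++ [gt]).length w →
            S.WireApprox P ptP N ptN BadP BadN (ap w) (fun x => wireOf x (vals (gs ++ [gt]) x) w) := by
      intro BadP' BadN' Fn hPP' hNN' hcP' hcN' hnewinv
      refine ⟨fun w => if w = .inr gs.length then Fn else ap w, BadP', BadN', hcP', hcN',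
        fun w hw => ?_⟩
      by_cases hwn : w = .inr gs.length
      · subst hwn
        simpa using hnewinv
      · dsimp only
        rw [if_neg hwn]
        refine hold BadP' BadN' hPP' hNN' w fun n hn => ?_
        have h1 := hw n hn
        simp only [List.length_append, List.length_singleton] at h1
        have h2 : n ≠ gs.length := fun h => hwn (hn.trans (by rw [h]))
        omega
    simp only [monotoneBasis, Set.mem_insert_iff, Set.mem_singleton_iff] at hgB
    rcases hgB with hc | hc
    · -- AND gate
      obtain ⟨u, v, rfl⟩ := exists_eq_andGate_of_fn_eq hc
      have hu : OutOK gs.length u := fun n hn => hgOK (0 : Fin 2) n hn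
      have hv : OutOK gs.length v := fun n hn => hgOK (1 : Fin 2) n hn
      have hnewinv := WireApprox.and_gate (hinv u hu) (hinv v hv)
      have hcP' : ∑ s ∈ BadP ∪ S.lostInf P ptP (ap u) (ap v), wP s ≤ ((gs.length + 1 : ℕ) : ℝ) * δP :=
        calc ∑ s ∈ BadP ∪ S.lostInf P ptP (ap u) (ap v), wP s
            ≤ ∑ s ∈ BadP, wP s + ∑ s ∈ S.lostInf P ptP (ap u) (ap v), wP s :=
              sum_union_le_of_nonneg hwP _ _
          _ ≤ gs.length * δP + δP := add_le_add hcP (hinfP _ _ (hinv u hu).ok (hinv v hv).ok)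
          _ = ((gs.length + 1 : ℕ) : ℝ) * δP := by push_cast; ring
      have hcN' : ∑ s ∈ BadN ∪ S.gainedInf N ptN (ap u) (ap v), wN s ≤ ((gs.length + 1 : ℕ) : ℝ) * δN :=
        calc ∑ s ∈ BadN ∪ S.gainedInf N ptN (ap u) (ap v), wN s
            ≤ ∑ s ∈ BadN, wN s + ∑ s ∈ S.gainedInf N ptN (ap u) (ap v), wN s :=
              sum_union_le_of_nonneg hwN _ _
          _ ≤ gs.length * δN + δN := add_le_add hcN (hinfN _ _ (hinv u hu).ok (hinv v hv).ok)
          _ = ((gs.length + 1 : ℕ) : ℝ) * δN := by push_cast; ring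
      refine assemble _ _ _ subset_union_left subset_union_left (by rw [hlen]; exact hcP')
        (by rw [hlen]; exact hcN') (hnewinv.congr fun x => ?_)
      rw [hnew, andGate_op]
    · -- OR gate
      obtain ⟨u, v, rfl⟩ := exists_eq_orGate_of_fn_eq hc
      have hu : OutOK gs.length u := fun n hn => hgOK (0 : Fin 2) n hn
      have hv : OutOK gs.length v := fun n hn => hgOK (1 : Fin 2) n hn
      have hnewinv := WireApprox.or_gate (hinv u hu) (hinv v hv)
      have hcP' : ∑ s ∈ BadP ∪ S.lostSup P ptP (ap u) (ap v), wP s ≤ ((gs.length + 1 : ℕ) : ℝ) * δP :=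
        calc ∑ s ∈ BadP ∪ S.lostSup P ptP (ap u) (ap v), wP s
            ≤ ∑ s ∈ BadP, wP s + ∑ s ∈ S.lostSup P ptP (ap u) (ap v), wP s :=
              sum_union_le_of_nonneg hwP _ _
          _ ≤ gs.length * δP + δP := add_le_add hcP (hsupP _ _ (hinv u hu).ok (hinv v hv).ok)
          _ = ((gs.length + 1 : ℕ) : ℝ) * δP := by push_cast; ring
      have hcN' : ∑ s ∈ BadN ∪ S.gainedSup N ptN (ap u) (ap v), wN s ≤ ((gs.length + 1 : ℕ) : ℝ) * δN :=
        calc ∑ s ∈ BadN ∪ S.gainedSup N ptN (ap u) (ap v), wN s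
            ≤ ∑ s ∈ BadN, wN s + ∑ s ∈ S.gainedSup N ptN (ap u) (ap v), wN s :=
              sum_union_le_of_nonneg hwN _ _
          _ ≤ gs.length * δN + δN := add_le_add hcN (hsupN _ _ (hinv u hu).ok (hinv v hv).ok)
          _ = ((gs.length + 1 : ℕ) : ℝ) * δN := by push_cast; ring
      refine assemble _ _ _ subset_union_left subset_union_left (by rw [hlen]; exact hcP')
        (by rw [hlen]; exact hcN') (hnewinv.congr fun x => ?_)
      rw [hnew, orGate_op]

omit [DecidableEq σ] [DecidableEq τ] [Inhabited β] in
/-- **The approximation method for a monotone circuit** (Razborov 1985; Alon–Boppana 1987,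
Thm. 2.1; CKR 2022, Lemma 2.18): a circuit over `{∧₂, ∨₂}` computing `f` has an approximator `a`
in the class and exceptional sets of weight `≤ size · δP`, `≤ size · δN` such that off the
exceptional sets `f = 1 ⇒ val a = 1` on positive and `val a = 1 ⇒ f = 1` on negative test
inputs. [cite: AlonBoppana1987, Thm. 2.1] -/
theorem exists_approx_circuit [DecidableEq σ] [DecidableEq τ] [Inhabited β] (P : Finset σ)
    (ptP : σ → ι → Bool) (wP : σ → ℝ) (N : Finset τ)
    (ptN : τ → ι → Bool) (wN : τ → ℝ) (hwP : ∀ s, 0 ≤ wP s) (hwN : ∀ s, 0 ≤ wN s) (δP δN : ℝ)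
    (hsupP : ∀ a b, S.ok a → S.ok b → ∑ s ∈ S.lostSup P ptP a b, wP s ≤ δP)
    (hinfP : ∀ a b, S.ok a → S.ok b → ∑ s ∈ S.lostInf P ptP a b, wP s ≤ δP)
    (hsupN : ∀ a b, S.ok a → S.ok b → ∑ s ∈ S.gainedSup N ptN a b, wN s ≤ δN)
    (hinfN : ∀ a b, S.ok a → S.ok b → ∑ s ∈ S.gainedInf N ptN a b, wN s ≤ δN)
    (C : Circuit ι) (hC : C.IsOver monotoneBasis) {f : (ι → Bool) → Bool} (hf : C.Computes f) :
    ∃ (a : β) (BadP : Finset σ) (BadN : Finset τ), S.ok a ∧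
      ∑ s ∈ BadP, wP s ≤ C.size * δP ∧ ∑ s ∈ BadN, wN s ≤ C.size * δN ∧
      (∀ s ∈ P, s ∉ BadP → f (ptP s) = true → S.val a (ptP s) = true) ∧
      (∀ s ∈ N, s ∉ BadN → S.val a (ptN s) = true → f (ptN s) = true) := by
  obtain ⟨ap, BadP, BadN, hcP, hcN, hinv⟩ :=
    S.exists_approx_gates P ptP wP N ptN wN hwP hwN δP δN hsupP hinfP hsupN hinfN C.gates
      (wf_gates C) hC
  have h := hinv C.output C.wf_output
  refine ⟨ap C.output, BadP, BadN, h.ok, hcP, hcN, fun s hs hsB hfs => h.pos s hs hsB ?_,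
    fun s hs hsB ha => ?_⟩
  · rw [← hfs, ← hf, circuit_eval]
  · have := h.neg s hs hsB ha
    rwa [← circuit_eval, hf] at this

omit [DecidableEq σ] [DecidableEq τ] [Inhabited β] in
/-- **Error accounting** (CKR 2022, proof of Thm. 2.19): with an approximator as in
`exists_approx_circuit`, `Pr⁺[f = 1] ≤ size · δP + Pr⁺[val a = 1]` and
`Pr⁻[f = 0] ≤ size · δN + Pr⁻[val a = 0]` for the weighted test families.
[cite: CavalarKumarRossman2022, Thm. 2.19] -/
theorem weight_le_of_approx [DecidableEq σ] [DecidableEq τ] {P : Finset σ} {ptP : σ → ι → Bool}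
    {wP : σ → ℝ} {N : Finset τ} {ptN : τ → ι → Bool} {wN : τ → ℝ} (hwP : ∀ s, 0 ≤ wP s)
    (hwN : ∀ s, 0 ≤ wN s) {a : β} {BadP : Finset σ} {BadN : Finset τ} {f : (ι → Bool) → Bool}
    {EP EN : ℝ} (hcP : ∑ s ∈ BadP, wP s ≤ EP) (hcN : ∑ s ∈ BadN, wN s ≤ EN)
    (hpos : ∀ s ∈ P, s ∉ BadP → f (ptP s) = true → S.val a (ptP s) = true)
    (hneg : ∀ s ∈ N, s ∉ BadN → S.val a (ptN s) = true → f (ptN s) = true) :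
    ∑ s ∈ P.filter (fun s => f (ptP s) = true), wP s
        ≤ EP + ∑ s ∈ P.filter (fun s => S.val a (ptP s) = true), wP s ∧
      ∑ s ∈ N.filter (fun s => f (ptN s) = false), wN s
        ≤ EN + ∑ s ∈ N.filter (fun s => S.val a (ptN s) = false), wN s := by
  constructor
  · have hsub : P.filter (fun s => f (ptP s) = true)
        ⊆ BadP ∪ P.filter (fun s => S.val a (ptP s) = true) := by
      intro s hs
      obtain ⟨hsP, hfs⟩ := mem_filter.1 hs
      by_cases hB : s ∈ BadP
      · exact mem_union_left _ hB
      · exact mem_union_right _ (mem_filter.2 ⟨hsP, hpos s hsP hB hfs⟩)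
    calc ∑ s ∈ P.filter (fun s => f (ptP s) = true), wP s
        ≤ ∑ s ∈ BadP ∪ P.filter (fun s => S.val a (ptP s) = true), wP s :=
          sum_le_sum_of_subset_of_nonneg hsub fun s _ _ => hwP s
      _ ≤ ∑ s ∈ BadP, wP s + ∑ s ∈ P.filter (fun s => S.val a (ptP s) = true), wP s :=
          sum_union_le_of_nonneg hwP _ _
      _ ≤ _ := add_le_add hcP le_rfl
  · have hsub : N.filter (fun s => f (ptN s) = false)
        ⊆ BadN ∪ N.filter (fun s => S.val a (ptN s) = false) := by
      intro s hs
      obtain ⟨hsN, hfs⟩ := mem_filter.1 hs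
      by_cases hB : s ∈ BadN
      · exact mem_union_left _ hB
      · refine mem_union_right _ (mem_filter.2 ⟨hsN, ?_⟩)
        rcases ha : S.val a (ptN s) with _ | _
        · rfl
        · rw [hneg s hsN hB ha] at hfs
          exact absurd hfs (by simp)
    calc ∑ s ∈ N.filter (fun s => f (ptN s) = false), wN s
        ≤ ∑ s ∈ BadN ∪ N.filter (fun s => S.val a (ptN s) = false), wN s :=
          sum_le_sum_of_subset_of_nonneg hsub fun s _ _ => hwN s
      _ ≤ ∑ s ∈ BadN, wN s + ∑ s ∈ N.filter (fun s => S.val a (ptN s) = false), wN s :=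
          sum_union_le_of_nonneg hwN _ _
      _ ≤ _ := add_le_add hcN le_rfl

end ApproxScheme

end Literature.Computability.Complexity
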